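import Summits.PneNP.GCT.Max.KYCannotSeparatePaddedPerFourFromFive
import HarnessLib
import HarnessLib.Audit

/-!
# `GCT/Max`: the BONFERRONI-2 truncation of the leading-label count `LT2_σ(n,p,k)` — a kernel device with `(k+1)²·((k+1)²+1)/2`
# families per pair instead of `2^{(k+1)²} − 1` (cell `pub-gct-max`, track F; theory-2 memo `FINDINGS-LT2.md` §4c, W2b/W2c)

`LT2_σ(n,p,k) = Σ_{I',J'} |⋃_{w ∈ I'×J'} A_w|` (`A_w` = the `(p+1)`-sets achievable with the witness `w`; `Max/DetKYLeadingTermsTwoCount.lean`).  The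
histogram mirror of `Max/DetKYLeadingTermsTwoHist.lean` evaluates the union by full inclusion–exclusion over the `2^{(k+1)²}−1` nonempty witness
families `C`, which at `k = 2` (`511` families per pair) limits kernel tables to `n ≤ 6`.  The second BONFERRONI inequality
`|⋃_w A_w| ≥ Σ_w |A_w| − Σ_{w<w'} |A_w ∩ A_w'|` (`sum_card_le_card_biUnion_add`, proved here by induction) gives a LOWER bound with only the
families of size `≤ 2` (`10` per pair at `k = 1`, `45` at `k = 2`), and a lower bound is all a ceiling certificate needs.  Numerically (theory-2,
`calc/bonf2k.py`) the truncation in the diagonal-sweep order, together with the one-family count, certifies EVERY cell at `(m,n) = (6,8), (7,9), (7,10),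
(8,10), (8,11), (9,12)` (worst target/bound `0.768, 0.837, 0.628, 0.927, 0.707, 0.779`), and its `k = 1` column is certified from `n ≈ 5m/4` for every
sampled `m ≤ 20` — one step above the full `LT2` threshold `≈ 6m/5`.

Contents: the depth-bounded recursion `ieRecD` (families of size `≤ d`) with its meaning `vget_ieRecD`; the Bonferroni inequality for a finite
family of finsets; its instance for the achievable sets (`bonf_le_card_achT`: `S₁ − S₂ ≤ |achT I' J'|`); kernel mirrors `pairBonf` / `rowBonf` on a
rank function with meanings; and the certificate on a SUB-LIST of rows (`le_kyRank_detPoly_of_bonfRows`: every row term of `LT2` is a sum of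
cardinalities, so any set of rows bounds the count from below) — packaged as `LT2BonferroniCertificate` (PROVED).  First user:
`Max/KYCannotSeparatePaddedPerSixFromEight.lean`.

HONEST FRAMING: an evaluation device (a weaker but cheaper lower bound) for the cell's own bound `LT2` — METHOD-CEILING statements for ONE flattening
family; nothing here bears on dc(per_m), VP vs VNP or P vs NP. Theory-2 gen 28. [folklore]
-/

open Finset

namespace Summit.PneNP.GCT

open Literature.Computability.AlgebraicComplexity Literature.Barriers.ValiantsHypothesis

namespace DetKYLeadingTermsTwo

open DetKYLeadingTerms (vpos)

/-! ## The depth-bounded inclusion–exclusion recursion -/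

section IERecD

variable {α : Type*} (N : ℕ) (wm : α → ℕ)

/-- `ieRecD N wm d ws M s st`: as `ieRec`, but at most `d` further witnesses may be intersected in (families of size `≤ d`). [folklore] -/
def ieRecD : ℕ → List α → ℕ → ℤ → Bool → List ℤ
  | _, [], M, s, st => if st then vbump (N + 1) (bits N M) s else vzero (N + 1)
  | 0, _ :: ws, M, s, st => ieRecD 0 ws M s st
  | d + 1, w :: ws, M, s, st => vadd (ieRecD (d + 1) ws M s st) (ieRecD d ws (M &&& wm w) (-s) true)

variable [DecidableEq α]

omit [DecidableEq α] in
/-- On the empty witness list only the flag term remains (any budget). [folklore] -/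
theorem vget_ieRecD_nil (d : ℕ) (M : ℕ) (s : ℤ) (st : Bool) (a : ℕ) :
    vget (ieRecD N wm d [] M s st) a = if st = true ∧ (bitSet N M).card = a then s else 0 := by
  have h : ieRecD N wm d [] M s st = ieRec N wm [] M s st := by cases d <;> rfl
  rw [h]
  exact vget_ieRec_nil N wm M s st a

omit [DecidableEq α] in
/-- With budget `0` only the flag term survives. [folklore] -/
theorem vget_ieRecD_zero (ws : List α) (M : ℕ) (s : ℤ) (st : Bool) (a : ℕ) :
    vget (ieRecD N wm 0 ws M s st) a = if st = true ∧ (bitSet N M).card = a then s else 0 := by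
  induction ws with
  | nil => exact vget_ieRecD_nil N wm 0 M s st a
  | cons w ws ih => rw [ieRecD]; exact ih

/-- **Meaning of the bounded recursion.** For a duplicate-free witness list `ws`:
`vget (ieRecD d ws M s st) a = [st ∧ |bitSet M| = a]·s + Σ_{∅ ≠ C ⊆ ws, |C| ≤ d} ieTerm M s a C`. [folklore] -/
theorem vget_ieRecD (d : ℕ) (ws : List α) (hws : ws.Nodup) (M : ℕ) (s : ℤ) (st : Bool) (a : ℕ) :
    vget (ieRecD N wm d ws M s st) a =
      (if st = true ∧ (bitSet N M).card = a then s else 0) +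
        ∑ C ∈ ws.toFinset.powerset.filter (fun C => C.Nonempty ∧ C.card ≤ d), ieTerm N wm M s a C := by
  induction ws generalizing d M s st with
  | nil =>
    have h0 : (([] : List α).toFinset.powerset.filter fun C => C.Nonempty ∧ C.card ≤ d) = ∅ := by
      ext C
      simp only [List.toFinset_nil, powerset_empty, mem_filter, mem_singleton, notMem_empty, iff_false, not_and]
      intro hC hne
      subst hC
      exact absurd hne Finset.not_nonempty_empty
    rw [vget_ieRecD_nil, h0, sum_empty, add_zero]
  | cons w ws ih =>
    have hw : w ∉ ws := (List.nodup_cons.1 hws).1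
    have hws' : ws.Nodup := (List.nodup_cons.1 hws).2
    have hwT : w ∉ ws.toFinset := fun h => hw (List.mem_toFinset.1 h)
    cases d with
    | zero =>
      rw [vget_ieRecD_zero]
      have h0 : ((w :: ws).toFinset.powerset.filter fun C => C.Nonempty ∧ C.card ≤ 0) = ∅ := by
        ext C
        simp only [mem_filter, Nat.le_zero, card_eq_zero, notMem_empty, iff_false, not_and]
        rintro - hne rfl
        exact Finset.not_nonempty_empty hne
      rw [h0, sum_empty, add_zero]
    | succ d =>
      rw [ieRecD, vget_vadd, ih (d + 1) hws' M s st, ih d hws' (M &&& wm w) (-s) true, List.toFinset_cons]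
      set T := ws.toFinset with hT
      -- split the families of `insert w T` of size ≤ d+1 into those avoiding `w` and those containing `w`
      have hsplit : ∑ C ∈ (insert w T).powerset.filter (fun C => C.Nonempty ∧ C.card ≤ d + 1), ieTerm N wm M s a C =
          (∑ C ∈ T.powerset.filter (fun C => C.Nonempty ∧ C.card ≤ d + 1), ieTerm N wm M s a C) +
            ∑ C ∈ T.powerset.filter (fun C => C.card ≤ d), ieTerm N wm M s a (insert w C) := by
        have key := sum_powerset_insert hwT (fun C => if (C.Nonempty ∧ C.card ≤ d + 1) then ieTerm N wm M s a C else 0)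
        rw [← sum_filter, ← sum_filter] at key
        rw [key]
        congr 1
        rw [sum_filter]
        refine sum_congr rfl fun C hC => ?_
        have hwC : w ∉ C := fun h => hwT (mem_powerset.1 hC h)
        simp only [insert_nonempty, true_and, card_insert_of_notMem hwC, Nat.add_le_add_iff_right]
      rw [hsplit]
      have hone : ∀ C ∈ T.powerset.filter (fun C => C.card ≤ d),
          ieTerm N wm M s a (insert w C) = ieTerm N wm (M &&& wm w) (-s) a C := by
        intro C hC
        have hwC : w ∉ C := fun h => hwT (mem_powerset.1 (mem_filter.1 hC).1 h)
        simp only [ieTerm, capCount_and N wm M w C, card_insert_of_notMem hwC, pow_succ]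
        split_ifs <;> ring
      rw [sum_congr rfl hone]
      -- the families containing `w`: the empty rest gives the flag term of the second call, the others its sum
      have hsplit2 : ∑ C ∈ T.powerset.filter (fun C => C.card ≤ d), ieTerm N wm (M &&& wm w) (-s) a C =
          ieTerm N wm (M &&& wm w) (-s) a ∅ +
            ∑ C ∈ T.powerset.filter (fun C => C.Nonempty ∧ C.card ≤ d), ieTerm N wm (M &&& wm w) (-s) a C := by
        have hdec : (T.powerset.filter fun C => C.card ≤ d) =
            insert ∅ (T.powerset.filter fun C => C.Nonempty ∧ C.card ≤ d) := by
          ext C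
          simp only [mem_filter, mem_powerset, mem_insert]
          constructor
          · rintro ⟨hCT, hcd⟩
            by_cases hC : C = ∅
            · exact Or.inl hC
            · exact Or.inr ⟨hCT, Finset.nonempty_iff_ne_empty.2 hC, hcd⟩
          · rintro (rfl | ⟨hCT, -, hcd⟩)
            · exact ⟨empty_subset _, by simp⟩
            · exact ⟨hCT, hcd⟩
        rw [hdec, sum_insert]
        simp
      rw [hsplit2]
      have hflag : ieTerm N wm (M &&& wm w) (-s) a ∅ = if (bitSet N (M &&& wm w)).card = a then -s else 0 := by
        rw [ieTerm, capCount_empty, card_empty, pow_zero, mul_one]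
      rw [hflag]
      simp only [true_and]
      ring

end IERecD

/-! ## The second Bonferroni inequality for a finite family of finsets -/

section Bonferroni

variable {ι β : Type*} [DecidableEq ι] [DecidableEq β]

/-- The intersection of the family members indexed by `C` (self-contained: filtered out of their own union; for `C = {i}` it is `f i`,
for `C = {i, j}` it is `f i ∩ f j`). [folklore] -/
def interF (f : ι → Finset β) (C : Finset ι) : Finset β := (C.biUnion f).filter fun x => ∀ i ∈ C, x ∈ f i

/-- `interF f {i, j} = f i ∩ f j`. [folklore] -/
theorem interF_pair (f : ι → Finset β) (i j : ι) : interF f {i, j} = f i ∩ f j := by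
  ext x
  simp only [interF, mem_filter, mem_biUnion, mem_insert, mem_singleton, forall_eq_or_imp, forall_eq, mem_inter]
  constructor
  · rintro ⟨-, h⟩; exact h
  · rintro ⟨h1, h2⟩; exact ⟨⟨i, Or.inl rfl, h1⟩, h1, h2⟩

/-- **Bonferroni, second inequality**: `Σ_i |f i| ≤ |⋃_i f i| + Σ_{{i,j} ⊆ s} |f i ∩ f j|`. [folklore] -/
theorem sum_card_le_card_biUnion_add (s : Finset ι) (f : ι → Finset β) :
    ∑ i ∈ s, (f i).card ≤ (s.biUnion f).card + ∑ C ∈ s.powersetCard 2, (interF f C).card := by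
  induction s using Finset.induction_on with
  | empty => simp
  | insert a s ha ih =>
    have hinj : Set.InjOn (fun C : Finset ι => insert a C) (↑(s.powersetCard 1) : Set (Finset ι)) := by
      intro C hC D hD hCD
      have hC' : a ∉ C := fun h => ha ((mem_powersetCard.1 hC).1 h)
      have hD' : a ∉ D := fun h => ha ((mem_powersetCard.1 hD).1 h)
      have hCD' : insert a C = insert a D := hCD
      rw [← erase_insert hC', hCD', erase_insert hD']
    have hdisj : Disjoint (s.powersetCard 2) ((s.powersetCard 1).image (insert a)) :=
      disjoint_left.2 fun C hC hC' => by
        obtain ⟨D, -, rfl⟩ := mem_image.1 hC'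
        exact ha ((mem_powersetCard.1 hC).1 (mem_insert_self a D))
    rw [sum_insert ha, biUnion_insert, powersetCard_succ_insert ha, sum_union hdisj, sum_image hinj]
    -- `|f a| + |B'| = |f a ∪ B'| + |f a ∩ B'|` and `|f a ∩ B'| ≤ Σ_i |f a ∩ f i|`
    have hcard := card_union_add_card_inter (f a) (s.biUnion f)
    have hint : (f a ∩ s.biUnion f).card ≤ ∑ i ∈ s, (interF f (insert a {i})).card := by
      rw [inter_biUnion]
      refine card_biUnion_le.trans (sum_le_sum fun i _ => ?_)
      rw [interF_pair]
    have h1 : ∑ C ∈ s.powersetCard 1, (interF f (insert a C)).card = ∑ i ∈ s, (interF f (insert a {i})).card := by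
      rw [powersetCard_one, sum_map]
      rfl
    rw [h1]
    omega

end Bonferroni

/-! ## The instance for the achievable sets: `S₁ − S₂ ≤ |achT I' J'|` -/

section AchT

variable {n p : ℕ} {σ : Equiv.Perm (Fin (n * n))} {I' J' : Finset (Fin n)}

/-- For a nonempty witness family `C ⊆ I' × J'`, `interF (achBy) C` is the filter `interT C`. [folklore] -/
theorem interF_achBy_eq (C : Finset (Fin n × Fin n)) (hC : C.Nonempty) :
    interF (achBy n p σ I' J') C = interT n p σ I' J' C := by
  ext T
  simp only [interF, interT, achBy, mem_filter, mem_biUnion]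
  constructor
  · rintro ⟨⟨w, hw, hT, -⟩, h⟩
    exact ⟨hT, fun w' hw' => (h w' hw').2⟩
  · rintro ⟨hT, h⟩
    obtain ⟨w, hw⟩ := hC
    exact ⟨⟨w, hw, hT, h w hw⟩, fun w' hw' => ⟨hT, h w' hw'⟩⟩

/-- The Bonferroni-2 term of one pair `(I', J')` at complement size `n² − (p+1)`:
`S₁ − S₂ = Σ_{w} C(a_w, ·) − Σ_{{w,w'}} C(a_{ww'}, ·)`, written over the families of size `1 ≤ |C| ≤ 2` with sign `(−1)^{|C|+1}`. [folklore] -/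
def bonfPair (n p : ℕ) (σ : Equiv.Perm (Fin (n * n))) (I' J' : Finset (Fin n)) : ℤ :=
  ∑ C ∈ (I' ×ˢ J').powerset.filter (fun C => C.Nonempty ∧ C.card ≤ 2),
    (-1 : ℤ) ^ (C.card + 1) * ((aCount n σ I' J' C).choose (n * n - (p + 1)) : ℤ)

/-- `S₁ − S₂ ≤ |achT I' J'|` (`p + 1 ≤ n²`). [folklore] -/
theorem bonfPair_le_card_achT (hp : p + 1 ≤ n * n) (I' J' : Finset (Fin n)) :
    bonfPair n p σ I' J' ≤ ((achT n p σ I' J').card : ℤ) := by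
  have hB := sum_card_le_card_biUnion_add (I' ×ˢ J') (achBy n p σ I' J')
  rw [← achT_eq_biUnion] at hB
  -- rewrite the two sums of the inequality as binomials of `aCount`
  have h1 : ∑ w ∈ I' ×ˢ J', (achBy n p σ I' J' w).card = ∑ C ∈ (I' ×ˢ J').powersetCard 1, (aCount n σ I' J' C).choose (n * n - (p + 1)) := by
    rw [powersetCard_one, sum_map]
    refine sum_congr rfl fun w hw => ?_
    change (achBy n p σ I' J' w).card = (aCount n σ I' J' {w}).choose (n * n - (p + 1))
    rw [← card_interT hp {w} (singleton_subset_iff.2 hw)]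
    congr 1
    ext T
    simp [achBy, interT]
  have h2 : ∑ C ∈ (I' ×ˢ J').powersetCard 2, (interF (achBy n p σ I' J') C).card =
      ∑ C ∈ (I' ×ˢ J').powersetCard 2, (aCount n σ I' J' C).choose (n * n - (p + 1)) := by
    refine sum_congr rfl fun C hC => ?_
    have hC2 := mem_powersetCard.1 hC
    rw [interF_achBy_eq C (card_pos.1 (by omega)), card_interT hp C hC2.1]
  rw [h1, h2] at hB
  -- split `bonfPair` into the size-1 and size-2 parts
  have hsplit : bonfPair n p σ I' J' =
      (∑ C ∈ (I' ×ˢ J').powersetCard 1, ((aCount n σ I' J' C).choose (n * n - (p + 1)) : ℤ)) -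
        ∑ C ∈ (I' ×ˢ J').powersetCard 2, ((aCount n σ I' J' C).choose (n * n - (p + 1)) : ℤ) := by
    have hdec : ((I' ×ˢ J').powerset.filter fun C => C.Nonempty ∧ C.card ≤ 2) =
        (I' ×ˢ J').powersetCard 1 ∪ (I' ×ˢ J').powersetCard 2 := by
      ext C
      simp only [mem_filter, mem_powerset, mem_union, mem_powersetCard]
      constructor
      · rintro ⟨hCT, hne, h2⟩
        have h1 : 1 ≤ C.card := card_pos.2 hne
        rcases Nat.lt_or_ge C.card 2 with h | h
        · exact Or.inl ⟨hCT, by omega⟩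
        · exact Or.inr ⟨hCT, by omega⟩
      · rintro (⟨hCT, h⟩ | ⟨hCT, h⟩)
        · exact ⟨hCT, card_pos.1 (by omega), by omega⟩
        · exact ⟨hCT, card_pos.1 (by omega), by omega⟩
    have hdisj : Disjoint ((I' ×ˢ J').powersetCard 1) ((I' ×ˢ J').powersetCard 2) :=
      disjoint_left.2 fun C h1 h2 => by
        have := (mem_powersetCard.1 h1).2; have := (mem_powersetCard.1 h2).2; omega
    rw [bonfPair, hdec, sum_union hdisj, sub_eq_add_neg, ← sum_neg_distrib]
    congr 1
    · exact sum_congr rfl fun C hC => by rw [(mem_powersetCard.1 hC).2]; ring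
    · exact sum_congr rfl fun C hC => by rw [(mem_powersetCard.1 hC).2]; ring
  rw [hsplit]
  have hB' : ((∑ C ∈ (I' ×ˢ J').powersetCard 1, (aCount n σ I' J' C).choose (n * n - (p + 1)) : ℕ) : ℤ) ≤
      ((achT n p σ I' J').card : ℤ) + ((∑ C ∈ (I' ×ˢ J').powersetCard 2, (aCount n σ I' J' C).choose (n * n - (p + 1)) : ℕ) : ℤ) := by
    exact_mod_cast hB
  push_cast at hB'
  linarith

end AchT

/-! ## Kernel mirrors on a rank function: `pairBonf`, `rowBonf`; meanings; the certificate on a sub-list of rows -/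

section Kernel

variable (n k : ℕ) (σ : Equiv.Perm (Fin (n * n))) (rk : ℕ → ℕ)

/-- The signed histogram of `a_C` over the families `C ⊆ I' × J'` of size `1` or `2` (KERNEL mirror). [folklore] -/
def pairBonf (I' J' : Finset (Fin n)) : List ℤ :=
  ieRecD (n * n) (wmask n rk I' J') 2 (wlist n I' J') (2 ^ (n * n) - 1) (-1) false

/-- The MATHEMATICAL Bonferroni histogram term of the pair `(I', J')` at `a`. [folklore] -/
def histBonfPair (I' J' : Finset (Fin n)) (a : ℕ) : ℤ :=
  ∑ C ∈ (I' ×ˢ J').powerset.filter (fun C => C.Nonempty ∧ C.card ≤ 2),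
    if (allowedP n σ I' J' C).card = a then (-1 : ℤ) ^ (C.card + 1) else 0

variable {σ rk}

/-- `vget (pairBonf I' J') a = histBonfPair I' J' a` (for `rk` the rank function of `σ`). [folklore] -/
theorem vget_pairBonf (hrk : ∀ q : Fin (n * n), ((σ q : Fin (n * n)) : ℕ) = rk q) (I' J' : Finset (Fin n)) (a : ℕ) :
    vget (pairBonf n rk I' J') a = histBonfPair n σ I' J' a := by
  rw [pairBonf, vget_ieRecD _ _ _ _ (wlist_nodup n I' J'), wlist_toFinset, histBonfPair]
  simp only [Bool.false_eq_true, false_and, if_false, zero_add]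
  refine sum_congr rfl fun C _ => ?_
  rw [ieTerm, ← card_allowedP_eq n I' J' hrk, pow_succ]
  split_ifs <;> ring

/-- The dot product of the pair histogram with the binomials is `bonfPair`. [folklore] -/
theorem sum_histBonfPair_mul (p : ℕ) (I' J' : Finset (Fin n)) :
    ∑ a ∈ range (n * n + 1), histBonfPair n σ I' J' a * binFac n a p = bonfPair n p σ I' J' := by
  rw [bonfPair]
  simp_rw [histBonfPair, sum_mul, ite_mul, zero_mul]
  rw [sum_comm]
  refine sum_congr rfl fun C _ => ?_
  have hmem : (allowedP n σ I' J' C).card ∈ range (n * n + 1) := by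
    rw [mem_range, Nat.lt_succ_iff]
    calc (allowedP n σ I' J' C).card ≤ (univ : Finset (Fin n × Fin n)).card := card_le_card (subset_univ _)
      _ = n * n := by rw [card_univ, Fintype.card_prod, Fintype.card_fin]
  rw [sum_ite_eq (range (n * n + 1)) ((allowedP n σ I' J' C).card) (fun a => (-1 : ℤ) ^ (C.card + 1) * binFac n a p), if_pos hmem,
    binFac, card_allowedP, Nat.choose_eq_descFactorial_div_factorial]

variable (σ rk)

/-- The row Bonferroni histogram (KERNEL mirror): `Σ_{J'}` of the pair histograms, as a vector. [folklore] -/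
def rowBonf (I' : Finset (Fin n)) : List ℤ :=
  (subsetsL n k).foldr (fun J' acc => vadd (pairBonf n rk I' J') acc) (vzero (n * n + 1))

variable {σ rk}

/-- The dot product of a row histogram with the binomials is at most the row's share `Σ_{J'} |achT I' J'|` of `LT2`. [folklore] -/
theorem rowBonf_dot_le (hrk : ∀ q : Fin (n * n), ((σ q : Fin (n * n)) : ℕ) = rk q) {p : ℕ} (hp : p + 1 ≤ n * n)
    (I' : Finset (Fin n)) :
    ∑ a ∈ range (n * n + 1), vget (rowBonf n k rk I') a * binFac n a p ≤
      ∑ J' ∈ (univ : Finset (Fin n)).powersetCard (k + 1), ((achT n p σ I' J').card : ℤ) := by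
  have h : ∀ a, vget (rowBonf n k rk I') a = ∑ J' ∈ (univ : Finset (Fin n)).powersetCard (k + 1), histBonfPair n σ I' J' a := by
    intro a
    rw [rowBonf, vget_foldr_vadd, vget_vzero, add_zero, sum_powersetCard_eq_subsetsL]
    simp only [vget_pairBonf n hrk]
  simp_rw [h, sum_mul]
  rw [sum_comm]
  refine sum_le_sum fun J' _ => ?_
  rw [sum_histBonfPair_mul]
  exact bonfPair_le_card_achT hp I' J'

/-- **Certificate on a sub-list of rows.** If `rows` is a duplicate-free list of `(k+1)`-subsets of `Fin n`, `vals` their kernel row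
histograms (`rowBonf n k rk I' = v`, one equation per row), and `b ≤ Σ_a (vals.foldr vadd 0)[a]·C(a, n²−1−p)`, then `b ≤ rank KY_{p,k}(det_n)`:
the rows not listed contribute nonnegative amounts to `LT2`. [folklore] -/
theorem le_kyRank_detPoly_of_bonfRows (K : Type*) [Field K] (hrk : ∀ q : Fin (n * n), ((σ q : Fin (n * n)) : ℕ) = rk q)
    {p : ℕ} (hp : p + 1 ≤ n * n) {rows : List (Finset (Fin n))} {vals : List (List ℤ)} (hnd : rows.Nodup)
    (hcard : ∀ I' ∈ rows, I'.card = k + 1) (h : List.Forall₂ (fun I' v => rowBonf n k rk I' = v) rows vals) (b : ℕ)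
    (hb : (b : ℤ) ≤ ∑ a ∈ range (n * n + 1), vget (vals.foldr vadd (vzero (n * n + 1))) a * binFac n a p) :
    b ≤ kyRank K p k (detPoly (Fin n) K) := by
  -- the listed rows, as kernel values, give `Σ_{I' ∈ rows} Σ_a vget (rowBonf I') a · binFac`
  have hfold : vals.foldr vadd (vzero (n * n + 1)) = rows.foldr (fun I' acc => vadd (rowBonf n k rk I') acc) (vzero (n * n + 1)) := by
    clear hb hcard hnd
    induction h with
    | nil => rfl
    | cons hI _ ih => rw [List.foldr_cons, List.foldr_cons, ← hI, ih]
  have hR : ∀ a, (rows.map fun I' => vget (rowBonf n k rk I') a).sum = ∑ I' ∈ rows.toFinset, vget (rowBonf n k rk I') a :=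
    fun a => (List.sum_toFinset _ hnd).symm
  rw [hfold] at hb
  simp_rw [vget_foldr_vadd, vget_vzero, add_zero, hR, sum_mul] at hb
  rw [sum_comm] at hb
  have h1 : ∑ I' ∈ rows.toFinset, ∑ a ∈ range (n * n + 1), vget (rowBonf n k rk I') a * binFac n a p ≤
      ∑ I' ∈ rows.toFinset, ∑ J' ∈ (univ : Finset (Fin n)).powersetCard (k + 1), ((achT n p σ I' J').card : ℤ) :=
    sum_le_sum fun I' _ => rowBonf_dot_le n k hrk hp I'
  have hsub : rows.toFinset ⊆ (univ : Finset (Fin n)).powersetCard (k + 1) := fun I' hI =>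
    mem_powersetCard.2 ⟨subset_univ _, hcard I' (List.mem_toFinset.1 hI)⟩
  have h2 : ∑ I' ∈ rows.toFinset, ∑ J' ∈ (univ : Finset (Fin n)).powersetCard (k + 1), ((achT n p σ I' J').card : ℤ) ≤
      ∑ I' ∈ (univ : Finset (Fin n)).powersetCard (k + 1), ∑ J' ∈ (univ : Finset (Fin n)).powersetCard (k + 1),
        ((achT n p σ I' J').card : ℤ) :=
    sum_le_sum_of_subset_of_nonneg hsub fun I' _ _ => sum_nonneg fun _ _ => Nat.cast_nonneg _
  have h3 : (∑ I' ∈ (univ : Finset (Fin n)).powersetCard (k + 1), ∑ J' ∈ (univ : Finset (Fin n)).powersetCard (k + 1),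
      ((achT n p σ I' J').card : ℤ)) = (lt2Count n p k σ : ℤ) := by
    rw [lt2Count_eq_sum_card_achT]; push_cast; rfl
  have hle : (b : ℤ) ≤ (lt2Count n p k σ : ℤ) := by linarith
  exact (by exact_mod_cast hle : b ≤ lt2Count n p k σ).trans (lt2Count_le_kyRank_detPoly K n p k σ)

end Kernel

/-! ### Kernel sanity: the three-witness toy of `Max/DetKYLeadingTermsTwoIERec.lean` with families of size ≤ 2 only (the size-3 term `+1` at index 1 is dropped). -/

example : ieRecD 4 (fun i : ℕ => 15 - 2 ^ i) 2 [0, 1, 2] 15 (-1) false = [0, 0, -3, 3, 0] := by decide +kernel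

end DetKYLeadingTermsTwo

/-! ## The packaged statement of this module (PROVED) -/

/-- `GCT/Max` support **LT2BonferroniCertificate** — the certificate on Bonferroni-2 row histograms: for all `n k p b σ rk`, a duplicate-free
list `rows` of `(k+1)`-subsets of `Fin n` with kernel values `vals` (`rowBonf n k rk I' = v` row by row), if `p + 1 ≤ n²`, `rk` is the rank
function of `σ`, and `b ≤ Σ_{a ≤ n²} (Σ vals)[a]·C(a, n²−1−p)`, then `b ≤ rank KY_{p,k}(det_n)` over `ℂ`.  A statement of the cell, PROVED below
(second Bonferroni inequality + `LT2 ≤ rank`). [folklore] -/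
def LT2BonferroniCertificate : Prop :=
  ∀ (n k p b : ℕ) (σ : Equiv.Perm (Fin (n * n))) (rk : ℕ → ℕ) (rows : List (Finset (Fin n))) (vals : List (List ℤ)),
    p + 1 ≤ n * n → (∀ q : Fin (n * n), ((σ q : Fin (n * n)) : ℕ) = rk q) → rows.Nodup → (∀ I' ∈ rows, I'.card = k + 1) →
      List.Forall₂ (fun I' v => DetKYLeadingTermsTwo.rowBonf n k rk I' = v) rows vals →
        (b : ℤ) ≤ ∑ a ∈ Finset.range (n * n + 1),
            DetKYLeadingTermsTwo.vget (vals.foldr DetKYLeadingTermsTwo.vadd (DetKYLeadingTermsTwo.vzero (n * n + 1))) a *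
              DetKYLeadingTermsTwo.binFac n a p →
          b ≤ kyRank ℂ p k (detPoly (Fin n) ℂ)

/-- `LT2BonferroniCertificate` holds. [folklore] -/
theorem lt2BonferroniCertificate_holds : LT2BonferroniCertificate :=
  fun n k _ b _ _ _ _ hp hrk hnd hcard h hb =>
    DetKYLeadingTermsTwo.le_kyRank_detPoly_of_bonfRows n k ℂ hrk hp hnd hcard h b hb

end Summit.PneNP.GCT
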